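import Summits.QuantumFields.YangMills.Theses.ThermodynamicCeilings
import Summits.QuantumFields.YangMills.Theorems.AntiScreeningCeilingsAbelTransfer

/-!
# Route `ThermodynamicCeilings` — `MirrorMonotoneDecay` (27771) from the pair spectral representation (the "one shared lemma")

D-0145 ideator seat ym-idea-11 (g5, lens «wuc»); answers the critic's remark (E1)/#35c (idea-crit-9): land ONE shared lemma
"torus mirror covariance of two parallel plaquettes = κ₀ + Laplace transform of a finite positive measure on (0,∞), δ ≤ 1" from
which the support `MirrorMonotoneDecay` follows and by which clause (i) of `WindowedSpectralMeasure` / `SubhomogeneousSpectralMeasureR`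
is discharged.  Here we prove the IMPLICATION: if, for every `β ≥ 0`, torus half-side `L`, plane `q` and axis `k`, the centred
plaquette–plaquette torus covariance `c_L(t)` admits the representation
`c_L(t) = κ₀ + ∫ (e^{-E(t-δ)} + e^{-E(2L+1-δ-t)}) dν(E)` (`ν` finite on `(0,∞)`, `κ₀ ≥ 0`, `δ ≤ 1`, `2 ≤ t ≤ 2L-1`) — verbatim
the shape of clause (i) of `AntiScreeningCeilings.SubhomogeneousSpectralMeasureR`, but for all `β ≥ 0` — then
`0 ≤ c_L(t+1) ≤ c_L(t)` for `2 ≤ t`, `t+1 ≤ L` (each profile `e^{-Ea} + e^{-E(T'-a)}` is non-negative and non-increasing up to the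
mirror point).  The hypothesis is what the transfer-matrix Literature (`WilsonTorusTransferMatrix.exists_spectralData_wilsonTorusTransferMatrix`,
`WilsonTorusTimeSlicing.integral_sliceFun_wilsonMeasure`, `PositiveKernelSpectralTraceTwo.hasSum_integral_iterate_insert_two`) is expected
to deliver; it is NOT proved here.  Pure real analysis + Mathlib; closes nothing by itself; no summit / leaf / NT / UV / IR statement is proved.
-/

namespace Summit.QuantumFields.YangMills.Theses.ThermodynamicCeilings

open MeasureTheory
open Summit.QuantumFields.YangMills.Cruxes.ScaleMonotonicity.Spectral (exp_integrable)

/-- One step of the mirror profile: for `E ≥ 0` and `a ≤ b`,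
`e^{-E(a+1)} + e^{-Eb} ≤ e^{-Ea} + e^{-E(b+1)}`. -/
theorem mirror_profile_step (E a b : ℝ) (hE : 0 ≤ E) (hab : a ≤ b) :
    Real.exp (-(E * (a + 1))) + Real.exp (-(E * b)) ≤ Real.exp (-(E * a)) + Real.exp (-(E * (b + 1))) := by
  have h1 : Real.exp (-(E * (a + 1))) = Real.exp (-(E * a)) * Real.exp (-E) := by
    rw [← Real.exp_add]; ring_nf
  have h2 : Real.exp (-(E * (b + 1))) = Real.exp (-(E * b)) * Real.exp (-E) := by
    rw [← Real.exp_add]; ring_nf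
  have hba : Real.exp (-(E * b)) ≤ Real.exp (-(E * a)) := Real.exp_le_exp.2 (by nlinarith)
  have hE1 : Real.exp (-E) ≤ 1 := by rw [Real.exp_le_one_iff]; linarith
  rw [h1, h2]
  nlinarith [mul_nonneg (sub_nonneg.2 hba) (sub_nonneg.2 hE1)]

open Literature.MathematicalPhysics.QuantumFieldTheory Literature.MathematicalPhysics.QuantumLattice
  Summit.QuantumFields.YangMills.Cruxes.OSLegsFromFemtoAndGap.DlrCollarTransfer in
/-- **`MirrorMonotoneDecay` from the pair spectral representation.**  The hypothesis is clause (i) of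
`SubhomogeneousSpectralMeasureR` asked for every `β ≥ 0` (the shared transfer-matrix lemma); the conclusion is the support item
`MirrorMonotoneDecay` (stmt-QuantumFields-27771) of route `ThermodynamicCeilings`. -/
theorem mirrorMonotoneDecay_of_pairSpectralRepresentation
    (hrep : ∀ (G : Type) [Group G] [TopologicalSpace G] [IsTopologicalGroup G] [CompactSpace G], IsCompactSimpleLieGroup G → Nonempty (G ≃ₜ* Matrix.specialUnitaryGroup (Fin 2) ℂ) → letI : MeasurableSpace G := borel G; haveI : BorelSpace G := ⟨rfl⟩; ∀ (r : LatticeRep G) (β : ℝ) (L : ℕ) (q : Fin 4 × Fin 4) (k : Fin 4), 0 ≤ β → q.1 < q.2 → ∃ (ν : MeasureTheory.Measure ℝ) (κ₀ : ℝ) (δ : ℕ), MeasureTheory.IsFiniteMeasure ν ∧ ν (Set.Iic 0) = 0 ∧ 0 ≤ κ₀ ∧ δ ≤ 1 ∧ (∀ t : ℕ, 2 ≤ t → t + 2 ≤ 2 * L + 1 → torusE G r β L (fun U => (plane G r q (fun i => if i = k then (t : ℤ) else 0) U - torusE G r β L (plane G r q (fun i => if i = k then (t : ℤ) else 0))) *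 (plane G r q (fun _ => 0) U - torusE G r β L (plane G r q (fun _ => 0)))) = κ₀ + ∫ E, (Real.exp (-(E * ((t : ℝ) - δ))) + Real.exp (-(E * (((2 * L + 1 : ℕ) : ℝ) - δ - (t : ℝ))))) ∂ν)) :
    MirrorMonotoneDecay := by
  intro G _ _ _ _ hG hiso r β L q k t hβ hq ht htL
  letI : MeasurableSpace G := borel G
  haveI : BorelSpace G := ⟨rfl⟩
  obtain ⟨ν, κ₀, δ, hfin, hsupp, hκ₀, hδ, hr⟩ := hrep G hG hiso r β L q k hβ hq
  haveI := hfin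
  have h0 := hr t ht (by omega)
  have h1 := hr (t + 1) (by omega) (by omega)
  rw [h0, h1]
  have hδR : (δ : ℝ) ≤ 1 := by exact_mod_cast hδ
  have htR : (2 : ℝ) ≤ (t : ℝ) := by exact_mod_cast ht
  have htLR : (t : ℝ) + 1 ≤ (L : ℝ) := by exact_mod_cast htL
  have hI : ∀ u : ℝ, 0 ≤ u → Integrable (fun E : ℝ => Real.exp (-(E * u))) ν := fun u hu => exp_integrable ν hsupp u hu
  have hI1 : Integrable (fun E : ℝ => Real.exp (-(E * (((t + 1 : ℕ) : ℝ) - δ))) +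
      Real.exp (-(E * (((2 * L + 1 : ℕ) : ℝ) - δ - ((t + 1 : ℕ) : ℝ))))) ν :=
    (hI _ (by push_cast; linarith)).add (hI _ (by push_cast; linarith))
  have hI0 : Integrable (fun E : ℝ => Real.exp (-(E * ((t : ℝ) - δ))) +
      Real.exp (-(E * (((2 * L + 1 : ℕ) : ℝ) - δ - (t : ℝ))))) ν :=
    (hI _ (by linarith)).add (hI _ (by push_cast; linarith))
  refine ⟨add_nonneg hκ₀ (integral_nonneg fun E => by positivity), add_le_add le_rfl (integral_mono_ae hI1 hI0 ?_)⟩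
  filter_upwards [measure_eq_zero_iff_ae_notMem.1 hsupp] with E hE
  have hE0 : 0 ≤ E := le_of_lt (not_le.1 hE)
  have hab : (t : ℝ) - δ ≤ (((2 * L + 1 : ℕ) : ℝ) - δ - (t : ℝ) - 1) := by push_cast; linarith
  have key := mirror_profile_step E ((t : ℝ) - δ) (((2 * L + 1 : ℕ) : ℝ) - δ - (t : ℝ) - 1) hE0 hab
  have ea : (((t + 1 : ℕ) : ℝ) - δ) = ((t : ℝ) - δ) + 1 := by push_cast; ring
  have eb' : (((2 * L + 1 : ℕ) : ℝ) - δ - (t : ℝ)) = (((2 * L + 1 : ℕ) : ℝ) - δ - (t : ℝ) - 1) + 1 := by ring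
  have eb : (((2 * L + 1 : ℕ) : ℝ) - δ - ((t + 1 : ℕ) : ℝ)) = (((2 * L + 1 : ℕ) : ℝ) - δ - (t : ℝ) - 1) := by
    push_cast; ring
  rw [ea, eb', eb]
  exact key

end Summit.QuantumFields.YangMills.Theses.ThermodynamicCeilings
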